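import Literature.AlgebraicGeometry.Resolution.RankOneReductionProofs
import Mathlib.RingTheory.EssentialFiniteness
import Mathlib.RingTheory.Adjoin.Polynomial.Basic
import HarnessLib

/-!
# Steer σ-residual, LOW half — D3a part 3: FRAME clauses of the torsor tower (`EssFiniteType`, `IsFractionRing`)

OURS (campaign res-hironaka, rung L, slot W4.1, crux `Steer` stmt-ResolutionOfSingularities-16345; res-L0-w41-plan-1 RULING 24c (q3):
«the frame clauses of 026's `NoEternalTamedMixedBranch` are delivered by the tower builder»; siblings `…LowTowerMoves` p517043,
`…LowTowerTorsor` p517570). Theses-free, definition-free. AI-produced; weaker than expert review; nothing of the manuscript asserted.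

* `isFractionRing_of_le` — `Frac (Y n) = L′` for every member above `Y 0` once `Frac (Y 0) = L′` (the tree's `isFractionRing_subalgebra_of_le`);
* `essFiniteType_adjoin_insert` — adjoining one element (the torsor generator `T n`) to an essentially-finite-type `k`-subalgebra keeps it
  essentially of finite type.
-/

noncomputable section

-- single-problem summit: the doubled namespace component `ResolutionOfSingularities` is forced
set_option linter.dupNamespace false

namespace Summit.ResolutionOfSingularities.ResolutionOfSingularities.Theorems.SwitchingDichotomy.LowTower

open Literature.AlgebraicGeometry.Resolution

variable {k L : Type} [Field k] [Field L] [Algebra k L]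

/-- **Frame clause `IsFractionRing (Y n) L′`**: members above a member with fraction field `L′` have fraction field `L′`. [folklore] -/
theorem isFractionRing_of_le (Y₀ Y : Subalgebra k L) (h : Y₀ ≤ Y) [IsFractionRing Y₀ L] : IsFractionRing Y L :=
  isFractionRing_subalgebra_of_le Y₀ Y h

/-- **Frame clause `EssFiniteType`**: `k[A, T]` is essentially of finite type over `k` when `A` is (it is of finite type over `A`).
[folklore] -/
theorem essFiniteType_adjoin_insert (A : Subalgebra k L) [hA : Algebra.EssFiniteType k A] (T : L) :
    Algebra.EssFiniteType k (Algebra.adjoin k (insert T (A : Set L))) := by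
  set Y := Algebra.adjoin k (insert T (A : Set L)) with hY
  have hAY : A ≤ Y := fun x hx => Algebra.subset_adjoin (Set.mem_insert_of_mem _ hx)
  letI : Algebra A Y := (Subalgebra.inclusion hAY).toAlgebra
  haveI : IsScalarTower k A Y := IsScalarTower.of_algebraMap_eq (fun c => rfl)
  -- `Y` is of finite type over `A`: generated by `T`
  haveI : Algebra.FiniteType A Y := by
    refine ⟨⟨{⟨T, Algebra.subset_adjoin (Set.mem_insert _ _)⟩}, ?_⟩⟩
    rw [eq_top_iff]
    rintro ⟨y₀, hy₀⟩ -
    rw [hY] at hy₀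
    induction hy₀ using Algebra.adjoin_induction with
    | mem x hx =>
      rcases hx with rfl | hx
      · exact Algebra.subset_adjoin (by simp)
      · have : (⟨x, _⟩ : Y) = algebraMap A Y ⟨x, hx⟩ := Subtype.ext rfl
        rw [this]; exact Subalgebra.algebraMap_mem _ _
    | algebraMap c =>
      have : (⟨algebraMap k L c, _⟩ : Y) = algebraMap A Y (algebraMap k A c) := Subtype.ext rfl
      rw [this]; exact Subalgebra.algebraMap_mem _ _
    | add x y hx hy ihx ihy =>
      have : (⟨x + y, Subalgebra.add_mem _ hx hy⟩ : Y) = ⟨x, hx⟩ + ⟨y, hy⟩ := rfl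
      rw [this]; exact Subalgebra.add_mem _ (ihx _) (ihy _)
    | mul x y hx hy ihx ihy =>
      have : (⟨x * y, Subalgebra.mul_mem _ hx hy⟩ : Y) = ⟨x, hx⟩ * ⟨y, hy⟩ := rfl
      rw [this]; exact Subalgebra.mul_mem _ (ihx _) (ihy _)
  exact Algebra.EssFiniteType.comp k A Y

end Summit.ResolutionOfSingularities.ResolutionOfSingularities.Theorems.SwitchingDichotomy.LowTower

end
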